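import Mathlib

/-!
# T5Coinvariants — coinvariants of a tensor product under a product character

Cell pub-hodge-repro2, Tier 5, sub-step N4.3 (route/T5-N4-p5.md (N4.3.P2-quinquies), owner p5,
lifted from p7's T5-CHECK-N43 §5(1)); kernel support by seat p4.  The prose uses, as «elementary»:
«coinvariants of a restricted tensor product under a product character are the restricted tensor
product of the local coinvariants — the relation `ω(h)φ − β′(h)φ` is generated place by place».

This file kernel-checks the two-factor case, which is the whole content (a finite tensor product
is handled by induction on the number of factors; the restricted tensor product over all places is
the directed union of the finite ones — neither is modelled here):

* `coinv S β` := the span of the relations `T x − β T • x` (`T ∈ S`, `x ∈ M`) — the kernel of the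
  projection onto the `β`-coinvariants `M_β = M ⧸ coinv S β`;
* `tensorSet S₁ S₂` := the operators `T₁ ⊗ T₂` on `M ⊗ N`, `T_i ∈ S_i` (the product action);
* `coinv_tensor`: for a character `β` on the product action with `β (T₁ ⊗ T₂) = β₁ T₁ * β₂ T₂`,
  and `S₁`, `S₂` containing the identity with `β_i (id) = 1`,
  `coinv (tensorSet S₁ S₂) β = (coinv S₁ β₁) ⊗ N ⊔ M ⊗ (coinv S₂ β₂)`
  (the right-hand side written as the ranges of `map m.subtype id` and `map id n.subtype`, the form
  used by Mathlib's `TensorProduct.quotientTensorQuotientEquiv`);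
* `coinvariantsTensorEquiv`: hence `M_{β₁} ⊗ N_{β₂} ≃ₗ (M ⊗ N)_β` — «the coinvariants of the tensor
  product are the tensor product of the coinvariants».
-/

namespace Summit.Ventures.HodgeRepro2.T5Coinvariants

open TensorProduct

variable {R : Type*} [CommRing R] {M N : Type*} [AddCommGroup M] [AddCommGroup N]
  [Module R M] [Module R N]

/-- The relations submodule of the `β`-coinvariants: the span of all `T x − β T • x`, `T ∈ S`. -/
def coinv (S : Set (M →ₗ[R] M)) (β : (M →ₗ[R] M) → R) : Submodule R M :=
  Submodule.span R {y | ∃ T ∈ S, ∃ x : M, T x - β T • x = y}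

/-- A relation `T x − β T • x` lies in `coinv S β`. -/
theorem relation_mem_coinv {S : Set (M →ₗ[R] M)} {β : (M →ₗ[R] M) → R} {T : M →ₗ[R] M}
    (hT : T ∈ S) (x : M) : T x - β T • x ∈ coinv S β :=
  Submodule.subset_span ⟨T, hT, x, rfl⟩

/-- The product action on `M ⊗ N`: the operators `T₁ ⊗ T₂`, `T₁ ∈ S₁`, `T₂ ∈ S₂`. -/
def tensorSet (S₁ : Set (M →ₗ[R] M)) (S₂ : Set (N →ₗ[R] N)) :
    Set (M ⊗[R] N →ₗ[R] M ⊗[R] N) :=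
  {U | ∃ T₁ ∈ S₁, ∃ T₂ ∈ S₂, TensorProduct.map T₁ T₂ = U}

/-- The pointwise identity behind «the relation is generated place by place»:
`(T₁ ⊗ T₂)(x₁ ⊗ x₂) − c₁ c₂ • x₁ ⊗ x₂ = (T₁ x₁ − c₁ • x₁) ⊗ T₂ x₂ + (c₁ • x₁) ⊗ (T₂ x₂ − c₂ • x₂)`. -/
theorem map_tmul_sub_smul (T₁ : M →ₗ[R] M) (T₂ : N →ₗ[R] N) (c₁ c₂ : R) (x₁ : M) (x₂ : N) :
    TensorProduct.map T₁ T₂ (x₁ ⊗ₜ x₂) - (c₁ * c₂) • (x₁ ⊗ₜ x₂)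
      = (T₁ x₁ - c₁ • x₁) ⊗ₜ T₂ x₂ + (c₁ • x₁) ⊗ₜ (T₂ x₂ - c₂ • x₂) := by
  simp only [map_tmul, sub_tmul, tmul_sub, smul_tmul', tmul_smul, smul_smul, mul_comm c₂ c₁]
  abel

section Product

variable (S₁ : Set (M →ₗ[R] M)) (S₂ : Set (N →ₗ[R] N)) (β₁ : (M →ₗ[R] M) → R)
  (β₂ : (N →ₗ[R] N) → R) (β : (M ⊗[R] N →ₗ[R] M ⊗[R] N) → R)

/-- `m ⊗ N` as a submodule of `M ⊗ N`, for `m ≤ M` (Mathlib's form). -/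
abbrev leftTensor (m : Submodule R M) : Submodule R (M ⊗[R] N) :=
  LinearMap.range (TensorProduct.map m.subtype (LinearMap.id : N →ₗ[R] N))

/-- `M ⊗ n` as a submodule of `M ⊗ N`, for `n ≤ N` (Mathlib's form). -/
abbrev rightTensor (n : Submodule R N) : Submodule R (M ⊗[R] N) :=
  LinearMap.range (TensorProduct.map (LinearMap.id : M →ₗ[R] M) n.subtype)

/-- `⊆`: every relation of the product action lies in `m ⊗ N ⊔ M ⊗ n`. -/
theorem coinv_tensor_le (hβ : ∀ T₁ ∈ S₁, ∀ T₂ ∈ S₂, β (TensorProduct.map T₁ T₂) = β₁ T₁ * β₂ T₂) :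
    coinv (tensorSet S₁ S₂) β ≤ leftTensor (N := N) (coinv S₁ β₁) ⊔ rightTensor (M := M) (coinv S₂ β₂) := by
  rw [coinv, Submodule.span_le]
  rintro _ ⟨_, ⟨T₁, hT₁, T₂, hT₂, rfl⟩, x, rfl⟩
  rw [hβ T₁ hT₁ T₂ hT₂]
  induction x using TensorProduct.induction_on with
  | zero => simp
  | tmul x₁ x₂ =>
    rw [map_tmul_sub_smul]
    refine Submodule.add_mem _ (Submodule.mem_sup_left ?_) (Submodule.mem_sup_right ?_)
    · exact ⟨⟨T₁ x₁ - β₁ T₁ • x₁, relation_mem_coinv hT₁ x₁⟩ ⊗ₜ T₂ x₂, by simp⟩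
    · exact ⟨(β₁ T₁ • x₁) ⊗ₜ ⟨T₂ x₂ - β₂ T₂ • x₂, relation_mem_coinv hT₂ x₂⟩, by simp⟩
  | add x y hx hy =>
    have : TensorProduct.map T₁ T₂ (x + y) - (β₁ T₁ * β₂ T₂) • (x + y)
        = (TensorProduct.map T₁ T₂ x - (β₁ T₁ * β₂ T₂) • x)
          + (TensorProduct.map T₁ T₂ y - (β₁ T₁ * β₂ T₂) • y) := by
      rw [map_add, smul_add]; abel
    rw [this]
    exact Submodule.add_mem _ hx hy

/-- `⊇`, left factor: `(coinv S₁ β₁) ⊗ N` lies in the relations of the product action. -/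
theorem leftTensor_le_coinv_tensor
    (hβ : ∀ T₁ ∈ S₁, ∀ T₂ ∈ S₂, β (TensorProduct.map T₁ T₂) = β₁ T₁ * β₂ T₂)
    (h2 : LinearMap.id ∈ S₂) (hβ2 : β₂ LinearMap.id = 1) :
    leftTensor (N := N) (coinv S₁ β₁) ≤ coinv (tensorSet S₁ S₂) β := by
  rw [leftTensor, TensorProduct.range_map_eq_span_tmul, Submodule.span_le]
  rintro _ ⟨⟨a, ha⟩, x₂, rfl⟩
  simp only [Submodule.coe_subtype, LinearMap.id_coe, id_eq]
  -- `a ⊗ x₂` is the image of `a ∈ coinv S₁ β₁` under the linear map `y ↦ y ⊗ x₂`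
  have : a ⊗ₜ[R] x₂ ∈ (coinv S₁ β₁).map ((TensorProduct.mk R M N).flip x₂) := ⟨a, ha, rfl⟩
  refine (Submodule.map_le_iff_le_comap.mpr ?_) this
  rw [coinv, Submodule.span_le]
  rintro _ ⟨T₁, hT₁, x₁, rfl⟩
  show (T₁ x₁ - β₁ T₁ • x₁) ⊗ₜ[R] x₂ ∈ coinv (tensorSet S₁ S₂) β
  have key : (T₁ x₁ - β₁ T₁ • x₁) ⊗ₜ[R] x₂
      = TensorProduct.map T₁ LinearMap.id (x₁ ⊗ₜ x₂)
        - β (TensorProduct.map T₁ LinearMap.id) • (x₁ ⊗ₜ x₂) := by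
    rw [hβ T₁ hT₁ _ h2, hβ2, mul_one, map_tmul, LinearMap.id_apply, sub_tmul, smul_tmul']
  rw [key]
  exact relation_mem_coinv (show TensorProduct.map T₁ LinearMap.id ∈ tensorSet S₁ S₂ from
    ⟨T₁, hT₁, LinearMap.id, h2, rfl⟩) _

/-- `⊇`, right factor: `M ⊗ (coinv S₂ β₂)` lies in the relations of the product action. -/
theorem rightTensor_le_coinv_tensor
    (hβ : ∀ T₁ ∈ S₁, ∀ T₂ ∈ S₂, β (TensorProduct.map T₁ T₂) = β₁ T₁ * β₂ T₂)
    (h1 : LinearMap.id ∈ S₁) (hβ1 : β₁ LinearMap.id = 1) :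
    rightTensor (M := M) (coinv S₂ β₂) ≤ coinv (tensorSet S₁ S₂) β := by
  rw [rightTensor, TensorProduct.range_map_eq_span_tmul, Submodule.span_le]
  rintro _ ⟨x₁, ⟨a, ha⟩, rfl⟩
  simp only [Submodule.coe_subtype, LinearMap.id_coe, id_eq]
  have : x₁ ⊗ₜ[R] a ∈ (coinv S₂ β₂).map (TensorProduct.mk R M N x₁) := ⟨a, ha, rfl⟩
  refine (Submodule.map_le_iff_le_comap.mpr ?_) this
  rw [coinv, Submodule.span_le]
  rintro _ ⟨T₂, hT₂, x₂, rfl⟩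
  show x₁ ⊗ₜ[R] (T₂ x₂ - β₂ T₂ • x₂) ∈ coinv (tensorSet S₁ S₂) β
  have key : x₁ ⊗ₜ[R] (T₂ x₂ - β₂ T₂ • x₂)
      = TensorProduct.map LinearMap.id T₂ (x₁ ⊗ₜ x₂)
        - β (TensorProduct.map LinearMap.id T₂) • (x₁ ⊗ₜ x₂) := by
    rw [hβ _ h1 T₂ hT₂, hβ1, one_mul, map_tmul, LinearMap.id_apply, tmul_sub, tmul_smul]
  rw [key]
  exact relation_mem_coinv (show TensorProduct.map LinearMap.id T₂ ∈ tensorSet S₁ S₂ from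
    ⟨LinearMap.id, h1, T₂, hT₂, rfl⟩) _

/-- **Coinvariants of a tensor product, the relations**: for a product character `β` on the
product action, `coinv (S₁ × S₂) β = (coinv S₁ β₁) ⊗ N ⊔ M ⊗ (coinv S₂ β₂)` — «the relation is
generated place by place». -/
theorem coinv_tensor (hβ : ∀ T₁ ∈ S₁, ∀ T₂ ∈ S₂, β (TensorProduct.map T₁ T₂) = β₁ T₁ * β₂ T₂)
    (h1 : LinearMap.id ∈ S₁) (h2 : LinearMap.id ∈ S₂) (hβ1 : β₁ LinearMap.id = 1)
    (hβ2 : β₂ LinearMap.id = 1) :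
    coinv (tensorSet S₁ S₂) β
      = leftTensor (N := N) (coinv S₁ β₁) ⊔ rightTensor (M := M) (coinv S₂ β₂) :=
  le_antisymm (coinv_tensor_le S₁ S₂ β₁ β₂ β hβ)
    (sup_le (leftTensor_le_coinv_tensor S₁ S₂ β₁ β₂ β hβ h2 hβ2)
      (rightTensor_le_coinv_tensor S₁ S₂ β₁ β₂ β hβ h1 hβ1))

/-- **Coinvariants of a tensor product**: `M_{β₁} ⊗ N_{β₂} ≃ₗ (M ⊗ N)_β` (Mathlib's
`quotientTensorQuotientEquiv` composed with `coinv_tensor`). -/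
noncomputable def coinvariantsTensorEquiv
    (hβ : ∀ T₁ ∈ S₁, ∀ T₂ ∈ S₂, β (TensorProduct.map T₁ T₂) = β₁ T₁ * β₂ T₂)
    (h1 : LinearMap.id ∈ S₁) (h2 : LinearMap.id ∈ S₂) (hβ1 : β₁ LinearMap.id = 1)
    (hβ2 : β₂ LinearMap.id = 1) :
    (M ⧸ coinv S₁ β₁) ⊗[R] (N ⧸ coinv S₂ β₂) ≃ₗ[R] (M ⊗[R] N) ⧸ coinv (tensorSet S₁ S₂) β :=
  (TensorProduct.quotientTensorQuotientEquiv (coinv S₁ β₁) (coinv S₂ β₂)).trans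
    (Submodule.quotEquivOfEq _ _ (coinv_tensor S₁ S₂ β₁ β₂ β hβ h1 h2 hβ1 hβ2).symm)

end Product

end Summit.Ventures.HodgeRepro2.T5Coinvariants
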